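/-
Copyright (c) 2026. All rights reserved.
Released under Apache 2.0 license as described in the file LICENSE.
Authors: abc-iut cell — seat abc-iut-w4-d104 (gen 3): file 3b of the row «Cor2.7(d)-second-half-at-disc-model»
((T1) of abc-iut-L4-t7's spec), over t2's `exists_continuousMulEquiv_sl` and the `OneParameterSubgroupsPSL2R*` chain.
-/
import Literature.AnabelianGeometry.AbsoluteAnabelian.OneParameterSubgroupsPSL2RExpForm
import Literature.AnabelianGeometry.AbsoluteAnabelian.AutHolomorphicSpacesPSL2RProofs
import Literature.AnabelianGeometry.AbsoluteAnabelian.AutHolomorphicSpacesCayleyProofs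
import Literature.AnabelianGeometry.AbsoluteAnabelian.ArchimedeanReconstructionStabilizerRotationsProofs
import HarnessLib

/-!
# [AbsTopIII] Cor 2.7 (d) at the disc model (III): orbits `S · p` of continuous one-parameter subgroups
# `S ⊆ 𝒜_𝕍(V^top) = Aut^hol(V)` are differentiable, with velocity zero exactly at fixed points

S. Mochizuki, *Topics in absolute anabelian geometry III* (bib key `MochizukiAbsTopIII2015`), Cor 2.7 (d),
kurims p.59: "If `S` is a one-parameter subgroup of `𝒜_𝕍(V^top)`, `p ∈ V^top`, and `L` is a line segment
one of whose endpoints is equal to `p`, then `L` is tangent to `S · p` at `p` if and only if …" — the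
tangency clause presupposes that the orbit `S · p` HAS a tangent direction at `p`.  This PROOF-ONLY file
(no definitions) supplies that fact for the typed reading of "one-parameter subgroup" (a continuous
homomorphism `f : ℝ → Aut^hol(V)`, compact-open topology, as in `OneParameterSubgroupsPSL2R` /
`oneParameterSubgroups_holAut_of`), completing the planar files
`ArchimedeanReconstructionStabilizerRotationsProofs` / `…OrthogonalFramesProofs` (where one-parameter
subgroups are planar families and velocities are `deriv`s):

* `exists_conj_expHom_of_continuous` — for an Aut-holomorphic disc `X`, every continuous
  `f : ℝ → Aut^hol(X)` is `t ↦ κ⁻¹ ∘ (exp (tA) · ) ∘ κ` along a biholomorphic `κ : X ⥲ ℍ`, `A` traceless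
  (Prop 2.2 (ii) `exists_continuousMulEquiv_sl` + `OneParameterSubgroupsPSL2R.exists_exp_form`);
* for a PLANAR Aut-holomorphic disc `V : Opens ℂ` (`IsAutHolDisc ↥V`, e.g. an open parallelogram):
  `differentiableAt_coe_symm_ofComplex`, `differentiableAt_coe_chart`, `deriv_coe_symm_ofComplex_ne_zero`
  (coordinate functions of `κ^{∓1}` are holomorphic with non-zero derivative),
  **`hasDerivAt_orbit_of_continuous`** — the orbit `t ↦ f(t) · p` is DIFFERENTIABLE at `t = 0` with velocity
  `(κ⁻¹)'(κp) · (A₀₁ + (A₀₀ − A₁₁) κp − A₁₀ (κp)²)`, **`deriv_orbit_eq_zero_iff_forall_fixed`** — velocity `0`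
  IFF `p` is fixed by every `f(t)`, and **`planarPicture_isOneParameterFamily`** — the planar picture
  `(t, z) ↦ f(t) · z` is a one-parameter family in the sense of `inner_eq_zero_iff_tangent_conj_orbits`
  (holomorphic self-maps of `V`, group law, `φ_0 = id`, jointly continuous), so that theorem applies to
  every one-parameter subgroup of `𝒜_𝕍(V^top)` and its `deriv`-velocities are honest tangents.

HONEST SCOPE: model level; classical Lie theory / complex analysis serving a cited reconstruction step of the
refereed [AbsTopIII] §2; nothing here bears on the disputed [IUTchIII] Cor. 3.12; typed ≠ endorsed.
-/

noncomputable section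

namespace Literature.AnabelianGeometry.AbsoluteAnabelian

open _root_.TopologicalSpace _root_.Topology _root_.Set _root_.Metric _root_.Function _root_.Filter
open scoped _root_.Manifold _root_.ContDiff ComplexConjugate UpperHalfPlane MatrixGroups
open _root_.UpperHalfPlane Literature.Analysis.Complex NormedSpace
open scoped Matrix.Norms.Operator

set_option backward.isDefEq.respectTransparency false

/-! ### Every continuous one-parameter subgroup of `Aut^hol(X)` is a conjugated matrix one-parameter group -/

/-- **Structure of the continuous one-parameter subgroups of `Aut^hol(X)`, `X` an Aut-holomorphic disc**:
along a biholomorphic `κ : X ⥲ ℍ` (the disc structure followed by the Cayley transform), a continuous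
homomorphism `f : ℝ → Aut^hol(X)` (compact-open topology) acts by `f(t) = κ⁻¹ ∘ (exp (tA) · ) ∘ κ` for a
traceless `A ∈ M₂(ℝ)` — Prop 2.2 (ii) `Aut^hol(X) ≅ SL₂(ℝ)/{±1}` (`exists_continuousMulEquiv_sl`) followed by
`OneParameterSubgroupsPSL2R.exists_exp_form`. [cite: MochizukiAbsTopIII2015, Corollary 2.7 (d) p.59] -/
theorem exists_conj_expHom_of_continuous (X : Type) [TopologicalSpace X] [T2Space X] [ChartedSpace ℂ X]
    [IsManifold 𝓘(ℂ, ℂ) ω X] (hX : IsAutHolDisc X)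
    (f : Multiplicative ℝ →* holAut (⊤ : Opens X)) :
    letI := homeoCompactOpen (⊤ : Opens X)
    Continuous f → ∃ κ : (⊤ : Opens X) ≃ₜ ℍ, MDifferentiable 𝓘(ℂ, ℂ) 𝓘(ℂ, ℂ) κ ∧
      MDifferentiable 𝓘(ℂ, ℂ) 𝓘(ℂ, ℂ) κ.symm ∧
      ∃ A : Matrix (Fin 2) (Fin 2) ℝ, A.trace = 0 ∧ ∃ φ : Multiplicative ℝ →* SL(2, ℝ),
        (∀ t : ℝ, ((φ (Multiplicative.ofAdd t) : SL(2, ℝ)) : Matrix (Fin 2) (Fin 2) ℝ) = exp (t • A)) ∧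
        ∀ (t : ℝ) (y : (⊤ : Opens X)),
          ((f (Multiplicative.ofAdd t) : holAut (⊤ : Opens X)) : (⊤ : Opens X) ≃ₜ (⊤ : Opens X)) y =
            κ.symm (φ (Multiplicative.ofAdd t) • κ y) := by
  letI := homeoCompactOpen (⊤ : Opens X)
  intro hf
  obtain ⟨e, he, hes⟩ := hX.exists_biholomorphic
  let tY : (⊤ : Opens X) ≃ₜ X :=
    { toFun := Subtype.val
      invFun := fun x => ⟨x, trivial⟩
      left_inv := fun _ => rfl
      right_inv := fun _ => rfl
      continuous_toFun := continuous_subtype_val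
      continuous_invFun := continuous_id.subtype_mk _ }
  have htY : MDifferentiable 𝓘(ℂ, ℂ) 𝓘(ℂ, ℂ) tY := fun y =>
    (mdifferentiableAt_opens_dom_iff (U := (⊤ : Opens X)) (Φ := id)
      (Ψ := fun y : (⊤ : Opens X) => (y : X)) (fun _ => rfl) y).2 mdifferentiableAt_id
  have htYs : MDifferentiable 𝓘(ℂ, ℂ) 𝓘(ℂ, ℂ) tY.symm := fun x =>
    (mdifferentiableAt_opens_cod_iff (V := (⊤ : Opens X))
      (Ψ := fun x : X => (⟨x, trivial⟩ : (⊤ : Opens X))) x).2 mdifferentiableAt_id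
  obtain ⟨C, hC, hCs, -, -⟩ := exists_cayley
  set κ : (⊤ : Opens X) ≃ₜ ℍ := (tY.trans e).trans C with hκdef
  have hκ : MDifferentiable 𝓘(ℂ, ℂ) 𝓘(ℂ, ℂ) κ := hC.comp (he.comp htY)
  have hκs : MDifferentiable 𝓘(ℂ, ℂ) 𝓘(ℂ, ℂ) κ.symm := htYs.comp (hes.comp hCs)
  obtain ⟨F, hF⟩ := exists_continuousMulEquiv_sl κ hκ hκs (holAut (⊤ : Opens X)) fun ψ => mem_holAut_iff ψ
  let f' : Multiplicative ℝ →* (SL(2, ℝ) ⧸ Subgroup.center SL(2, ℝ)) := F.symm.toMonoidHom.comp f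
  have hf' : Continuous f' := F.symm.continuous.comp hf
  obtain ⟨A, hA, φ, -, hφ, hfφ⟩ := OneParameterSubgroupsPSL2R.exists_exp_form f' hf'
  refine ⟨κ, hκ, hκs, A, hA, φ, hφ, fun t y => ?_⟩
  have h1 : F (f' (Multiplicative.ofAdd t)) = f (Multiplicative.ofAdd t) := F.apply_symm_apply _
  rw [← h1, hfφ t, hF]
  rfl

/-! ### Planar Aut-holomorphic discs: orbits of continuous one-parameter subgroups are differentiable -/

section Planar

variable (V : Opens ℂ)

/-- The coordinate function `ℍ → ℂ` of a biholomorphic `κ⁻¹ : ℍ → ⊤ ⊆ V` (followed by the inclusions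
`⊤ → V → ℂ`), read on `ℂ` through `ofComplex`, is complex-differentiable at the points of the upper half
plane. [cite: MochizukiAbsTopIII2015, Corollary 2.7 (d) p.59] -/
theorem differentiableAt_coe_symm_ofComplex (κ : (⊤ : Opens V) ≃ₜ ℍ)
    (hκs : MDifferentiable 𝓘(ℂ, ℂ) 𝓘(ℂ, ℂ) κ.symm) (τ : ℍ) :
    DifferentiableAt ℂ (fun w : ℂ => (((κ.symm (ofComplex w) : (⊤ : Opens V)) : V) : ℂ)) (τ : ℂ) := by
  have h1 : MDifferentiableAt 𝓘(ℂ, ℂ) 𝓘(ℂ, ℂ) (Subtype.val ∘ κ.symm) τ :=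
    (mdifferentiableAt_opens_cod_iff (V := (⊤ : Opens V)) (Ψ := κ.symm) τ).1 (hκs τ)
  have h2 : MDifferentiableAt 𝓘(ℂ, ℂ) 𝓘(ℂ, ℂ) (Subtype.val ∘ (Subtype.val ∘ κ.symm)) τ :=
    (mdifferentiableAt_opens_cod_iff (V := V) (Ψ := Subtype.val ∘ κ.symm) τ).1 h1
  have h3 := (mdifferentiableAt_comp_ofComplex_iff (f := Subtype.val ∘ (Subtype.val ∘ κ.symm)) (τ := τ)).2 h2
  exact mdifferentiableAt_iff_differentiableAt.mp h3

/-- The coordinate function of `κ` (read on `ℂ`, junk off `V`) is complex-differentiable at points of `V`.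
[cite: MochizukiAbsTopIII2015, Corollary 2.7 (d) p.59] -/
theorem differentiableAt_coe_chart (κ : (⊤ : Opens V) ≃ₜ ℍ) (hκ : MDifferentiable 𝓘(ℂ, ℂ) 𝓘(ℂ, ℂ) κ)
    (x : V) :
    DifferentiableAt ℂ (Function.extend Subtype.val (fun x : V => ((κ ⟨x, trivial⟩ : ℍ) : ℂ)) (fun z => z))
      (x : ℂ) := by
  have hj : MDifferentiableAt 𝓘(ℂ, ℂ) 𝓘(ℂ, ℂ) (fun x : V => (⟨x, trivial⟩ : (⊤ : Opens V))) x :=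
    (mdifferentiableAt_opens_cod_iff (V := (⊤ : Opens V)) (Ψ := fun x : V => (⟨x, trivial⟩ : (⊤ : Opens V)))
      x).2 mdifferentiableAt_id
  have h1 : MDifferentiableAt 𝓘(ℂ, ℂ) 𝓘(ℂ, ℂ) (fun x : V => ((κ ⟨x, trivial⟩ : ℍ) : ℂ)) x :=
    ((UpperHalfPlane.mdifferentiable_coe _).comp _ (hκ _)).comp x hj
  have h2 := (mdifferentiableAt_opens_dom_iff (U := V)
    (Φ := Function.extend Subtype.val (fun x : V => ((κ ⟨x, trivial⟩ : ℍ) : ℂ)) (fun z => z))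
    (Ψ := fun x : V => ((κ ⟨x, trivial⟩ : ℍ) : ℂ))
    (fun x => (Subtype.val_injective.extend_apply (fun x : V => ((κ ⟨x, trivial⟩ : ℍ) : ℂ))
      (fun z => z) x).symm) x).1 h1
  exact mdifferentiableAt_iff_differentiableAt.mp h2

/-- The coordinate function of `κ⁻¹` has NON-ZERO derivative (it has the coordinate function of `κ` as a
holomorphic left inverse near the point). [cite: MochizukiAbsTopIII2015, Corollary 2.7 (d) p.59] -/
theorem deriv_coe_symm_ofComplex_ne_zero (κ : (⊤ : Opens V) ≃ₜ ℍ) (hκ : MDifferentiable 𝓘(ℂ, ℂ) 𝓘(ℂ, ℂ) κ)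
    (hκs : MDifferentiable 𝓘(ℂ, ℂ) 𝓘(ℂ, ℂ) κ.symm) (τ : ℍ) :
    deriv (fun w : ℂ => (((κ.symm (ofComplex w) : (⊤ : Opens V)) : V) : ℂ)) (τ : ℂ) ≠ 0 := by
  set G : ℂ → ℂ := fun w : ℂ => (((κ.symm (ofComplex w) : (⊤ : Opens V)) : V) : ℂ) with hG
  set K : ℂ → ℂ := Function.extend Subtype.val (fun x : V => ((κ ⟨x, trivial⟩ : ℍ) : ℂ)) (fun z => z)
    with hK
  have hGd : DifferentiableAt ℂ G (τ : ℂ) := differentiableAt_coe_symm_ofComplex V κ hκs τ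
  have hKd : DifferentiableAt ℂ K (G τ) := by
    have h := differentiableAt_coe_chart V κ hκ ((κ.symm (ofComplex (τ : ℂ)) : (⊤ : Opens V)) : V)
    exact h
  -- `K ∘ G = id` on the upper half plane, an open neighbourhood of `τ`
  have hKG : ∀ w : ℂ, 0 < w.im → K (G w) = w := by
    intro w hw
    simp only [hK, hG]
    rw [Subtype.val_injective.extend_apply]
    have : (⟨((κ.symm (ofComplex w) : (⊤ : Opens V)) : V), trivial⟩ : (⊤ : Opens V)) = κ.symm (ofComplex w) := rfl
    rw [this, Homeomorph.apply_symm_apply, ofComplex_apply_of_im_pos hw]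
  have hev : id =ᶠ[𝓝 (τ : ℂ)] (K ∘ G) := by
    have hopen : IsOpen {w : ℂ | 0 < w.im} := isOpen_lt continuous_const Complex.continuous_im
    filter_upwards [hopen.mem_nhds (show (τ : ℂ) ∈ {w : ℂ | 0 < w.im} from τ.im_pos)] with w hw
    exact (hKG w hw).symm
  have hcomp : HasDerivAt (K ∘ G) (deriv K (G τ) * deriv G (τ : ℂ)) (τ : ℂ) :=
    hKd.hasDerivAt.comp (τ : ℂ) hGd.hasDerivAt
  have h1 : deriv K (G τ) * deriv G (τ : ℂ) = 1 := (hcomp.congr_of_eventuallyEq hev).unique (hasDerivAt_id _)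
  intro h0
  rw [h0, mul_zero] at h1
  exact zero_ne_one h1

/-- **Orbits of continuous one-parameter subgroups are differentiable** ((T1) of the spec of the row
«Cor2.7(d)-second-half-at-disc-model»): for `V ⊆ ℂ` an Aut-holomorphic disc (`IsAutHolDisc ↥V`, e.g. an open
parallelogram) and a continuous homomorphism `f : ℝ → Aut^hol(V) = 𝒜_𝕍(V^top)` (compact-open topology), the
planar orbit `t ↦ f(t) · p` of every point `p ∈ V` is differentiable at `t = 0`; moreover there are a
biholomorphic `κ : V ⥲ ℍ` and a traceless `A` with `f(t) = κ⁻¹ ∘ (exp tA ·) ∘ κ`, and the velocity is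
`(coordinate of κ⁻¹)'(κ p) · (A₀₁ + (A₀₀ − A₁₁) κp − A₁₀ (κp)²)`. [cite: MochizukiAbsTopIII2015, Corollary 2.7 (d) p.59] -/
theorem hasDerivAt_orbit_of_continuous (hV : IsAutHolDisc V)
    (f : Multiplicative ℝ →* holAut (⊤ : Opens V)) (p : V) :
    letI := homeoCompactOpen (⊤ : Opens V)
    Continuous f → ∃ (κ : (⊤ : Opens V) ≃ₜ ℍ) (A : Matrix (Fin 2) (Fin 2) ℝ) (φ : Multiplicative ℝ →* SL(2, ℝ)),
      MDifferentiable 𝓘(ℂ, ℂ) 𝓘(ℂ, ℂ) κ ∧ MDifferentiable 𝓘(ℂ, ℂ) 𝓘(ℂ, ℂ) κ.symm ∧ A.trace = 0 ∧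
      (∀ t : ℝ, ((φ (Multiplicative.ofAdd t) : SL(2, ℝ)) : Matrix (Fin 2) (Fin 2) ℝ) = exp (t • A)) ∧
      (∀ (t : ℝ) (y : (⊤ : Opens V)),
        ((f (Multiplicative.ofAdd t) : holAut (⊤ : Opens V)) : (⊤ : Opens V) ≃ₜ (⊤ : Opens V)) y =
          κ.symm (φ (Multiplicative.ofAdd t) • κ y)) ∧
      HasDerivAt (fun t : ℝ =>
          (((((f (Multiplicative.ofAdd t) : holAut (⊤ : Opens V)) : (⊤ : Opens V) ≃ₜ (⊤ : Opens V))
            ⟨p, trivial⟩ : (⊤ : Opens V)) : V) : ℂ))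
        (deriv (fun w : ℂ => (((κ.symm (ofComplex w) : (⊤ : Opens V)) : V) : ℂ)) ((κ ⟨p, trivial⟩ : ℍ) : ℂ) *
          (((A 0 1 : ℝ) : ℂ) + (((A 0 0 : ℝ) : ℂ) - ((A 1 1 : ℝ) : ℂ)) * ((κ ⟨p, trivial⟩ : ℍ) : ℂ) -
            ((A 1 0 : ℝ) : ℂ) * ((κ ⟨p, trivial⟩ : ℍ) : ℂ) ^ 2)) 0 := by
  letI := homeoCompactOpen (⊤ : Opens V)
  intro hf
  obtain ⟨κ, hκ, hκs, A, hA, φ, hφ, hfφ⟩ := exists_conj_expHom_of_continuous V hV f hf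
  refine ⟨κ, A, φ, hκ, hκs, hA, hφ, hfφ, ?_⟩
  set τ : ℍ := κ ⟨p, trivial⟩ with hτ
  set G : ℂ → ℂ := fun w : ℂ => (((κ.symm (ofComplex w) : (⊤ : Opens V)) : V) : ℂ) with hG
  have hfun : (fun t : ℝ => (((((f (Multiplicative.ofAdd t) : holAut (⊤ : Opens V)) :
      (⊤ : Opens V) ≃ₜ (⊤ : Opens V)) ⟨p, trivial⟩ : (⊤ : Opens V)) : V) : ℂ)) =
      fun t : ℝ => G (((φ (Multiplicative.ofAdd t) • τ : ℍ) : ℂ)) := by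
    funext t
    rw [hfφ t, hG]
    simp only [ofComplex_apply]
    rfl
  rw [hfun]
  have hγ := OneParameterSubgroupsPSL2R.hasDerivAt_coe_expHom_smul A hA φ hφ τ
  have hG0 : DifferentiableAt ℂ G ((fun t : ℝ => ((φ (Multiplicative.ofAdd t) • τ : ℍ) : ℂ)) 0) := by
    have h := differentiableAt_coe_symm_ofComplex V κ hκs (φ (Multiplicative.ofAdd 0) • τ)
    exact h
  have h := hasDerivAt_comp_real_curve (k := G) hG0.hasDerivAt hγ
  have h0 : ((φ (Multiplicative.ofAdd 0) • τ : ℍ) : ℂ) = (τ : ℂ) := by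
    rw [show Multiplicative.ofAdd (0 : ℝ) = 1 from rfl, map_one, one_smul]
  beta_reduce at h
  rw [h0] at h
  exact h

/-- **Velocity zero IFF the point is fixed by the whole one-parameter subgroup** (second clause of (T1)):
for `f` and `p` as above, the orbit `t ↦ f(t) · p` has `deriv = 0` at `t = 0` IFF `f(t) · p = p` for all
`t` — so through a NON-fixed point the orbit `S · p` has a genuine tangent direction at `p`.
[cite: MochizukiAbsTopIII2015, Corollary 2.7 (d) p.59] -/
theorem deriv_orbit_eq_zero_iff_forall_fixed (hV : IsAutHolDisc V)
    (f : Multiplicative ℝ →* holAut (⊤ : Opens V)) (p : V) :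
    letI := homeoCompactOpen (⊤ : Opens V)
    Continuous f → (deriv (fun t : ℝ =>
        (((((f (Multiplicative.ofAdd t) : holAut (⊤ : Opens V)) : (⊤ : Opens V) ≃ₜ (⊤ : Opens V))
          ⟨p, trivial⟩ : (⊤ : Opens V)) : V) : ℂ)) 0 = 0 ↔
      ∀ t : ℝ, ((f (Multiplicative.ofAdd t) : holAut (⊤ : Opens V)) : (⊤ : Opens V) ≃ₜ (⊤ : Opens V))
        ⟨p, trivial⟩ = ⟨p, trivial⟩) := by
  letI := homeoCompactOpen (⊤ : Opens V)
  intro hf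
  obtain ⟨κ, A, φ, hκ, hκs, hA, hφ, hfφ, hder⟩ := hasDerivAt_orbit_of_continuous V hV f p hf
  rw [hder.deriv]
  constructor
  · intro h0
    have hne := deriv_coe_symm_ofComplex_ne_zero V κ hκ hκs (κ ⟨p, trivial⟩)
    have hgen := (mul_eq_zero.1 h0).resolve_left hne
    have hfix := (OneParameterSubgroupsPSL2R.forall_expHom_smul_eq_iff A hA φ hφ (κ ⟨p, trivial⟩)).2 hgen
    intro t
    rw [hfφ t, hfix t, Homeomorph.symm_apply_apply]
  · intro hfix
    have hgen : ∀ t : ℝ, φ (Multiplicative.ofAdd t) • κ ⟨p, trivial⟩ = κ ⟨p, trivial⟩ := by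
      intro t
      have h := hfix t
      rw [hfφ t] at h
      have h' := congrArg κ h
      rwa [Homeomorph.apply_symm_apply] at h'
    rw [(OneParameterSubgroupsPSL2R.forall_expHom_smul_eq_iff A hA φ hφ (κ ⟨p, trivial⟩)).1 hgen, mul_zero]

/-- **The planar picture of a continuous one-parameter subgroup of `Aut^hol(V)` is a one-parameter family
in the sense of `ArchimedeanReconstructionOrthogonalFramesProofs`**: writing
`φ_t := (z ↦ f(t) · z)` extended by the identity off `V`, each `φ_t` is holomorphic on `V` and maps `V` into
`V`, `φ_{s+t} = φ_s ∘ φ_t` on `V`, `φ_0 = id` on `V`, `(t, z) ↦ φ_t(z)` is jointly continuous on `ℝ × V`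
(evaluation is continuous for the compact-open topology on the locally compact `V`), and on `V` it IS the
action of `f` — so `inner_eq_zero_iff_tangent_conj_orbits` applies to `φ` and its orbits are differentiable
(`hasDerivAt_orbit_of_continuous`). [cite: MochizukiAbsTopIII2015, Corollary 2.7 (d) p.59] -/
theorem planarPicture_isOneParameterFamily (f : Multiplicative ℝ →* holAut (⊤ : Opens V)) :
    letI := homeoCompactOpen (⊤ : Opens V)
    Continuous f →
    let φ : ℝ → ℂ → ℂ := fun t => (Function.extend Subtype.val
      (fun x : V => (((((f (Multiplicative.ofAdd t) : holAut (⊤ : Opens V)) : (⊤ : Opens V) ≃ₜ (⊤ : Opens V))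
        ⟨x, trivial⟩ : (⊤ : Opens V)) : V) : ℂ)) (fun z => z))
    (∀ (t : ℝ) (x : V), φ t x = (((((f (Multiplicative.ofAdd t) : holAut (⊤ : Opens V)) :
        (⊤ : Opens V) ≃ₜ (⊤ : Opens V)) ⟨x, trivial⟩ : (⊤ : Opens V)) : V) : ℂ)) ∧
    (∀ t, DifferentiableOn ℂ (φ t) V ∧ MapsTo (φ t) V V) ∧
    (∀ s t, ∀ z ∈ (V : Set ℂ), φ (s + t) z = φ s (φ t z)) ∧ (∀ z ∈ (V : Set ℂ), φ 0 z = z) ∧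
    ContinuousOn (fun q : ℝ × ℂ => φ q.1 q.2) (univ ×ˢ (V : Set ℂ)) := by
  letI := homeoCompactOpen (⊤ : Opens V)
  intro hf φ
  -- abbreviation for the action of `f t` on `V`
  have hval : ∀ (t : ℝ) (x : V), φ t x = (((((f (Multiplicative.ofAdd t) : holAut (⊤ : Opens V)) :
      (⊤ : Opens V) ≃ₜ (⊤ : Opens V)) ⟨x, trivial⟩ : (⊤ : Opens V)) : V) : ℂ) :=
    fun t x => Subtype.val_injective.extend_apply _ _ x
  have hmem : ∀ (t : ℝ) (x : V), φ t x ∈ (V : Set ℂ) := fun t x => by rw [hval]; exact Subtype.prop _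
  refine ⟨hval, fun t => ⟨fun z hz => ?_, fun z hz => hmem t ⟨z, hz⟩⟩, fun s t z hz => ?_, fun z hz => ?_, ?_⟩
  · -- holomorphic on `V`
    set x : V := ⟨z, hz⟩
    have hj : MDifferentiableAt 𝓘(ℂ, ℂ) 𝓘(ℂ, ℂ) (fun x : V => (⟨x, trivial⟩ : (⊤ : Opens V))) x :=
      (mdifferentiableAt_opens_cod_iff (V := (⊤ : Opens V))
        (Ψ := fun x : V => (⟨x, trivial⟩ : (⊤ : Opens V))) x).2 mdifferentiableAt_id
    have hft : MDifferentiable 𝓘(ℂ, ℂ) 𝓘(ℂ, ℂ)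
        ((f (Multiplicative.ofAdd t) : holAut (⊤ : Opens V)) : (⊤ : Opens V) ≃ₜ (⊤ : Opens V)) :=
      ((mem_holAut_iff _).1 (f (Multiplicative.ofAdd t)).2).1
    have hv1 : MDifferentiable 𝓘(ℂ, ℂ) 𝓘(ℂ, ℂ) (fun y : (⊤ : Opens V) => (y : V)) := fun y =>
      (mdifferentiableAt_opens_dom_iff (U := (⊤ : Opens V)) (Φ := id)
        (Ψ := fun y : (⊤ : Opens V) => (y : V)) (fun _ => rfl) y).2 mdifferentiableAt_id
    have hv2 : MDifferentiable 𝓘(ℂ, ℂ) 𝓘(ℂ, ℂ) (fun x : V => (x : ℂ)) := fun x =>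
      (mdifferentiableAt_opens_dom_iff (U := V) (Φ := id) (Ψ := fun x : V => (x : ℂ)) (fun _ => rfl) x).2
        mdifferentiableAt_id
    have hΨ : MDifferentiableAt 𝓘(ℂ, ℂ) 𝓘(ℂ, ℂ) (fun x : V => (((((f (Multiplicative.ofAdd t) :
        holAut (⊤ : Opens V)) : (⊤ : Opens V) ≃ₜ (⊤ : Opens V)) ⟨x, trivial⟩ : (⊤ : Opens V)) : V) : ℂ)) x :=
      ((hv2 _).comp _ ((hv1 _).comp _ (hft _))).comp x hj
    have hΦ := (mdifferentiableAt_opens_dom_iff (U := V) (Φ := φ t)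
      (Ψ := fun x : V => (((((f (Multiplicative.ofAdd t) : holAut (⊤ : Opens V)) :
        (⊤ : Opens V) ≃ₜ (⊤ : Opens V)) ⟨x, trivial⟩ : (⊤ : Opens V)) : V) : ℂ))
      (fun x => (hval t x).symm) x).1 hΨ
    exact (mdifferentiableAt_iff_differentiableAt.mp hΦ).differentiableWithinAt
  · -- group law on `V`
    have hz' : φ t z ∈ (V : Set ℂ) := hmem t ⟨z, hz⟩
    rw [show z = ((⟨z, hz⟩ : V) : ℂ) from rfl, hval, show φ t (⟨z, hz⟩ : V) = ((⟨φ t (⟨z, hz⟩ : V), hz'⟩ : V) : ℂ)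
      from rfl, hval]
    have heq : (⟨φ t (⟨z, hz⟩ : V), hz'⟩ : V) = (((f (Multiplicative.ofAdd t) : holAut (⊤ : Opens V)) :
        (⊤ : Opens V) ≃ₜ (⊤ : Opens V)) ⟨⟨z, hz⟩, trivial⟩ : (⊤ : Opens V)) := Subtype.ext (hval t ⟨z, hz⟩)
    rw [heq, ofAdd_add, map_mul]
    rfl
  · -- `φ 0 = id` on `V`
    rw [show z = ((⟨z, hz⟩ : V) : ℂ) from rfl, hval, show Multiplicative.ofAdd (0 : ℝ) = 1 from rfl, map_one]
    rfl
  · -- joint continuity on `ℝ × V`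
    haveI : LocallyCompactSpace V := V.2.locallyCompactSpace
    haveI : LocallyCompactSpace (⊤ : Opens V) := (⊤ : Opens V).2.locallyCompactSpace
    have hE : Continuous fun q : ℝ × V => (((((f (Multiplicative.ofAdd q.1) : holAut (⊤ : Opens V)) :
        (⊤ : Opens V) ≃ₜ (⊤ : Opens V)) ⟨q.2, trivial⟩ : (⊤ : Opens V)) : V) : ℂ) := by
      have h1 : Continuous fun t : ℝ => (((f (Multiplicative.ofAdd t) : holAut (⊤ : Opens V)) :
          (⊤ : Opens V) ≃ₜ (⊤ : Opens V)) : C((⊤ : Opens V), (⊤ : Opens V))) :=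
        continuous_induced_dom.comp (continuous_subtype_val.comp (hf.comp continuous_ofAdd))
      have h2 : Continuous fun q : ℝ × V => ((((f (Multiplicative.ofAdd q.1) : holAut (⊤ : Opens V)) :
          (⊤ : Opens V) ≃ₜ (⊤ : Opens V)) : C((⊤ : Opens V), (⊤ : Opens V))) (⟨q.2, trivial⟩ : (⊤ : Opens V))) :=
        (h1.comp continuous_fst).eval (continuous_snd.subtype_mk fun _ => trivial)
      exact continuous_subtype_val.comp (continuous_subtype_val.comp h2)
    have hΦ : IsOpenEmbedding (Prod.map (id : ℝ → ℝ) (Subtype.val : V → ℂ)) :=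
      IsOpenEmbedding.id.prodMap V.2.isOpenEmbedding_subtypeVal
    intro q hq
    obtain ⟨-, hq2⟩ := mem_prod.1 hq
    set x₀ : ℝ × V := (q.1, ⟨q.2, hq2⟩)
    have hqx : q = Prod.map id Subtype.val x₀ := Prod.ext rfl rfl
    have hcomp : (fun q : ℝ × ℂ => φ q.1 q.2) ∘ Prod.map id Subtype.val = fun q : ℝ × V =>
        (((((f (Multiplicative.ofAdd q.1) : holAut (⊤ : Opens V)) : (⊤ : Opens V) ≃ₜ (⊤ : Opens V))
          ⟨q.2, trivial⟩ : (⊤ : Opens V)) : V) : ℂ) := by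
      funext q; exact hval q.1 q.2
    refine ContinuousAt.continuousWithinAt ?_
    rw [ContinuousAt, hqx, ← hΦ.map_nhds_eq, tendsto_map'_iff, hcomp]
    have hlim : φ (Prod.map id Subtype.val x₀).1 (Prod.map id Subtype.val x₀).2 =
        (((((f (Multiplicative.ofAdd x₀.1) : holAut (⊤ : Opens V)) : (⊤ : Opens V) ≃ₜ (⊤ : Opens V))
          ⟨x₀.2, trivial⟩ : (⊤ : Opens V)) : V) : ℂ) := hval x₀.1 x₀.2
    rw [hlim]
    exact hE.continuousAt

end Planar

end Literature.AnabelianGeometry.AbsoluteAnabelian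

end
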